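import Literature.Computability.Complexity.AdaptiveQueries
import Literature.Computability.Complexity.TruthTableFunctions
import HarnessLib

/-!
# Adaptive oracle transducers: the function `x ↦ G ⟨x, adaptive answer bits⟩` is in `FP^A`

Topic `Computability/Complexity`, the function-valued companion of `AdaptiveQueries.lean` (whose
`adAlg Q q D` DECIDES the adaptively reduced language `adLang Q q D A ∈ P^A`) in the way
`TruthTableFunctions.lean` (`ttFnAlg`, non-adaptive) accompanies `TruthTableClosure.lean`. A
polynomial-time **adaptive oracle transducer** (Ladner–Lynch–Selman 1975, §2: polynomial-time
Turing reducibility, the next query may depend on the answers received so far; Arora–Barak 2009,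
§3.4 and §17.2: `FP` with an oracle) is given by a query generator `Q ∈ FP` reading the input AND
the answer bits received so far, a polynomial round budget `q`, and an output map `G ∈ FP`; against
a language oracle `A` it computes

  `adFn Q q G A x = G ⟨x, b₀ b₁ ⋯ b_{q(|x|)-1}⟩`,  `bᵢ = [Q ⟨x, b₀ ⋯ b_{i-1}⟩ ∈ A]`

(the answer bits `adBits Q A x i` of `AdaptiveQueries.lean`).

Main results: `adFnAlg Q q G : OracleAlg (List Bool)` (ask `Q ⟨x, answers⟩` while fewer than
`q(|x|)` answers are in, then output `G ⟨x, answers⟩`), `run_adFnAlg` (it outputs `adFn Q q G A x`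
within any budget of more than `q(|x|)` rounds, for EVERY language `A` — one machine for all
oracles), `exists_of_mem_queries_adFnAlg`, `length_le_of_mem_queries_adFnAlg` (its queries have
length `≤ s(2|x| + 2 + q|x|)` for an output bound `s` of `Q`), `isPolyTime_adFnAlg` (the step
function is the string map `adFnStepS = condFn (GoOn q) (adQryS Q) (outS G)` of the two companion
files), and **`adFn_mem_FPRel`**: `adFn Q q G A ∈ FP^A`. This is the shape of every "compute with
the help of the oracle, then output" machine whose queries are computed from earlier answers — e.g.
bit-by-bit binary search (Arora–Barak 2009, §17.2.1) or the `SampBPP^{TQBF,O}` simulator of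
Aaronson–Chen 2017, Lemma 5.3, which is the consumer (`Literature/Barriers/QuantumAdvantage/`).

## References

* R. E. Ladner, N. A. Lynch, A. L. Selman, *A comparison of polynomial time reducibilities*,
  Theoret. Comput. Sci. 1 (1975) 103–123, §2 (`≤ᵖ_T`) [LadnerLynchSelman1975].
* S. Arora, B. Barak, *Computational Complexity: A Modern Approach*, CUP 2009, §3.4 (oracle
  machines), §17.2 (`FP` with an oracle), §17.2.1 (binary search with an oracle) [AroraBarak2009].
-/

namespace Literature.Computability.Complexity

open _root_.Computability Polynomial PRelSigma OracleCompose TTClosure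

namespace AdQuery

section Defs

variable (Q : List Bool → List Bool) (q : Polynomial ℕ) (G : List Bool → List Bool)

/-- **The function computed by an adaptive oracle transducer** against the language `A`:
`x ↦ G ⟨x, adBits Q A x (q |x|)⟩` — the output map applied to the input and the `q(|x|)` adaptively
obtained answer bits. [cite: LadnerLynchSelman1975, §2] -/
noncomputable def adFn (A : Language Bool) (x : List Bool) : List Bool :=
  G (boolPair x (adBits Q A x (q.eval x.length)))

/-- **The adaptive oracle transducer**: while fewer than `q(|x|)` answers have been received, ask
`Q ⟨x, answers⟩` (the one-symbol answers flattened to a bit string); then output `G ⟨x, answers⟩`.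
[cite: LadnerLynchSelman1975, §2] -/
noncomputable def adFnAlg : OracleAlg (List Bool) where
  step x ans :=
    if ans.length < q.eval x.length then Sum.inl (Q (boolPair x ans.flatten))
    else Sum.inr (G (boolPair x ans.flatten))

end Defs

variable {Q : List Bool → List Bool} {q : Polynomial ℕ} {G : List Bool → List Bool}

/-- Unfolding lemma for `adFn`. [folklore] -/
theorem adFn_apply (A : Language Bool) (x : List Bool) :
    adFn Q q G A x = G (boolPair x (adBits Q A x (q.eval x.length))) :=
  rfl

/-- The step of `adFnAlg` before the last query has been answered is the next query. [folklore] -/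
theorem adFnAlg_step_of_lt (x : List Bool) {ans : List (List Bool)} (h : ans.length < q.eval x.length) :
    (adFnAlg Q q G).step x ans = Sum.inl (Q (boolPair x ans.flatten)) := by
  simp [adFnAlg, h]

/-- The step of `adFnAlg` after all answers is the output. [folklore] -/
theorem adFnAlg_step_of_le (x : List Bool) {ans : List (List Bool)} (h : q.eval x.length ≤ ans.length) :
    (adFnAlg Q q G).step x ans = Sum.inr (G (boolPair x ans.flatten)) := by
  simp [adFnAlg, Nat.not_lt.2 h]

/-- **The transcript of `adFnAlg` is the list of adaptive answer bits.** [folklore] -/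
theorem trans_adFnAlg (A : Language Bool) (x : List Bool) :
    ∀ i ≤ q.eval x.length, trans (adFnAlg Q q G) (Oracle.ofLanguage A) x i = bitsTrans (adBits Q A x i)
  | 0, _ => by simp
  | i + 1, hi => by
    have ih := trans_adFnAlg A x i (Nat.le_of_succ_le hi)
    rw [trans_succ, ih, qryOf_eq_of_step_eq (adFnAlg_step_of_lt x (by simpa using hi)),
      ofLanguage_eq_singleton, adBits_succ, bitsTrans_append, bitsTrans_singleton, flatten_bitsTrans]

/-- **`adFnAlg` computes `adFn`** within any budget of more than `q(|x|)` rounds, against every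
language oracle. [cite: LadnerLynchSelman1975, §2] -/
theorem run_adFnAlg (A : Language Bool) (x : List Bool) {n : ℕ} (hn : q.eval x.length < n) :
    (adFnAlg Q q G).run (Oracle.ofLanguage A) n x = some (adFn Q q G A x) := by
  rw [run_eq_some_iff]
  refine ⟨q.eval x.length, hn, fun i hi => ⟨Q (boolPair x (adBits Q A x i)), ?_⟩, ?_⟩
  · rw [trans_adFnAlg A x i hi.le, adFnAlg_step_of_lt x (by simpa using hi), flatten_bitsTrans]
  · rw [trans_adFnAlg A x _ le_rfl, adFnAlg_step_of_le x (by simp), flatten_bitsTrans]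
    rfl

/-- **The queries of `adFnAlg` are the intended ones**: every recorded query is `Q ⟨x, adBits … i⟩`
for some `i < q(|x|)`. [folklore] -/
theorem exists_of_mem_queries_adFnAlg (A : Language Bool) (x : List Bool) {n : ℕ} {y : List Bool}
    (hy : y ∈ (adFnAlg Q q G).queries (Oracle.ofLanguage A) n x) :
    ∃ i < q.eval x.length, y = Q (boolPair x (adBits Q A x i)) := by
  obtain ⟨i, -, hall, rfl⟩ := exists_of_mem_queries _ _ n x y hy
  have hi : i < q.eval x.length := by
    by_contra hle
    obtain ⟨y', hy'⟩ := hall (q.eval x.length) (Nat.not_lt.1 hle)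
    rw [trans_adFnAlg A x _ le_rfl, adFnAlg_step_of_le x (by simp)] at hy'
    cases hy'
  refine ⟨i, hi, ?_⟩
  rw [trans_adFnAlg A x i hi.le, qryOf_eq_of_step_eq (adFnAlg_step_of_lt x (by simpa using hi)),
    flatten_bitsTrans]

/-- **The queries of `adFnAlg` are polynomially short**: with an output-length bound `s` of `Q`,
every query on `x` has length `≤ s(2|x| + 2 + q|x|)` (the code of `⟨x, bits⟩` with `|bits| < q(|x|)`
has length `< 2|x| + 2 + q(|x|)`). [cite: AroraBarak2009, §3.4] -/
theorem length_le_of_mem_queries_adFnAlg {s : Polynomial ℕ} (hs : ∀ z, (Q z).length ≤ s.eval z.length)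
    (A : Language Bool) (x : List Bool) {n : ℕ} {y : List Bool}
    (hy : y ∈ (adFnAlg Q q G).queries (Oracle.ofLanguage A) n x) :
    y.length ≤ s.eval (2 * x.length + 2 + q.eval x.length) := by
  obtain ⟨i, hi, rfl⟩ := exists_of_mem_queries_adFnAlg A x hy
  refine (hs _).trans ?_
  rw [length_boolPair, length_adBits]
  exact TM2Iter.eval_mono s (by omega)

/-! ### The step function of `adFnAlg` as a string map -/

section Step

variable (Q q G)

/-- **The step function of `adFnAlg` as a string map**: guarded by "fewer than `q(|x|)` answers"
(`TTClosure.GoOn`), the query code `0 · Q ⟨x, flattened answers⟩` (`adQryS`, `AdaptiveQueries.lean`),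
else the output code `1 · G ⟨x, flattened answers⟩` (`outS`, `TruthTableFunctions.lean`). [folklore] -/
noncomputable def adFnStepS : List Bool → List Bool := condFn (GoOn q) (adQryS Q) (outS G)

variable {Q q G}

/-- **`adFnStepS ∈ FP`** for `Q, G ∈ FP`. [folklore] -/
theorem adFnStepS_mem_FP (hQ : Q ∈ FP) (hG : G ∈ FP) : adFnStepS Q q G ∈ FP :=
  condFn_mem_FP (GoOn_mem_P q) (adQryS_mem_FP hQ) (outS_mem_FP hG)

/-- **The string map computes the step function.** [folklore] -/
theorem adFnStepS_apply (x : List Bool) (ans : List (List Bool)) :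
    adFnStepS Q q G (boolPair x ((encodingList Bool).listBool.encode ans)) =
      stepCodeL ((adFnAlg Q q G).step x ans) := by
  by_cases h : ans.length < q.eval x.length
  · rw [adFnStepS, condFn_of_mem _ _ ((mem_GoOn_iff x ans).2 h), adFnAlg_step_of_lt x h, adQryS_apply,
      stepCodeL_inl]
  · rw [adFnStepS, condFn_of_not_mem _ _ (fun h' => h ((mem_GoOn_iff x ans).1 h')),
      adFnAlg_step_of_le x (Nat.not_lt.1 h), outS_apply, stepCodeL_inr]

/-- **`adFnAlg` is polynomial-time** for `Q, G ∈ FP`. [cite: AroraBarak2009, §3.4] -/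
theorem isPolyTime_adFnAlg (hQ : Q ∈ FP) (hG : G ∈ FP) :
    (adFnAlg Q q G).IsPolyTime (encodingList Bool) := by
  obtain ⟨p, Mx, h⟩ := adFnStepS_mem_FP (q := q) hQ hG
  refine ⟨p, Mx, fun z => ?_⟩
  have hz := h (boolPair z.1 ((encodingList Bool).listBool.encode z.2))
  rw [id, adFnStepS_apply] at hz
  exact hz

end Step

/-! ### Main result -/

/-- **Adaptive oracle transducers compute `FP^A` functions**: `adFn Q q G A ∈ FP^A` for
`Q, G ∈ FP` — round budget `q + 1`, query lengths `≤ s(2|x| + 2 + q|x|)` for an output bound `s` of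
`Q` (`ttBudget q s`). [cite: LadnerLynchSelman1975, §2] -/
theorem adFn_mem_FPRel (hQ : Q ∈ FP) (hG : G ∈ FP) (A : Language Bool) :
    adFn Q q G A ∈ FPRel (Oracle.ofLanguage A) := by
  obtain ⟨s, hs⟩ := exists_poly_length_le_of_mem_FP hQ
  refine ⟨adFnAlg Q q G, isPolyTime_adFnAlg hQ hG, ttBudget q s, fun x => ⟨?_, fun y hy => ?_⟩⟩
  · exact run_adFnAlg A x (by rw [ttBudget_eval]; omega)
  · refine (length_le_of_mem_queries_adFnAlg hs A x hy).trans ?_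
    rw [ttBudget_eval]
    exact Nat.le_add_left _ _

/-- `adFn Q q G A ∈ FP^C`-style corollary: for `A ∈ C`, `adFn Q q G A` is computed in `FP` relative
to a member of `C`. [cite: LadnerLynchSelman1975, §2] -/
theorem exists_mem_adFn_mem_FPRel (hQ : Q ∈ FP) (hG : G ∈ FP) {C : Set (Language Bool)}
    {A : Language Bool} (hA : A ∈ C) :
    ∃ L ∈ C, adFn Q q G A ∈ FPRel (Oracle.ofLanguage L) :=
  ⟨A, hA, adFn_mem_FPRel hQ hG A⟩

end AdQuery

end Literature.Computability.Complexity
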